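import Summits.HubbardSuperconductivity.HubbardSuperconductivity.Theorems.JosephsonMirrorJmInterchangeNormalForm
import Summits.HubbardSuperconductivity.HubbardSuperconductivity.Theorems.JosephsonMirrorJmInterchangeResidualNecessity

/-!
# Route `JosephsonMirror` — crux `JmInterchange` (stmt-HubbardSuperconductivity-2227), line `Sketch` (lead c1):
# the EXACT two-residue normal form of the crux

`jmInterchange_iff_reachesFloor_and_bridges`: the crux `JmInterchange` (uniform linear Josephson gain of the window
double ⇒ ground-floor pair bridge, universally in `(U, δ)`) is EQUIVALENT to the conjunction of two single-layer
statements about `hubbardTorus 2 L 1 U` alone, each quantified over every `U > 0`, `δ ∈ (0, 1/2)`: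

* (R1) ZERO-EXCESS PAIR ORDER REACHES THE FLOOR — if for some `c > 0` and every `ε > 0`, eventually in even `L`, a
  unit vector of sector `N_L` or `N_L − 2` (`S^z = 0`) lies within `εL²` of its sector floor and has `‖Δ_d v‖² ≥ cL⁴`,
  then eventually some unit ground state `g` of `(N_L, 0)` has `‖Δ_d g‖² ≥ c'L⁴`;
* (R2') FLOOR ORDER BRIDGES — if eventually some unit ground state `g` of `(N_L, 0)` has `‖Δ_d g‖² ≥ cL⁴`, then
  eventually some unit ground-floor pair `φ ∈ G(N_L, 0)`, `χ ∈ G(N_L − 2, 0)` has `|⟨χ, Δ_d φ⟩|² ≥ a'L⁴`.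

Both are NECESSARY ((R1): `floorOrder_of_zeroExcessPairOrder_of_jmInterchange`; (R2'): a ground state has zero
excess, `zeroExcessPairOrder_of_floorOrder`, then the single-layer form of the crux `jmInterchange_iff_singleLayerForm`)
and jointly SUFFICIENT (compose and use the single-layer form backwards).  So the crux has no slack beyond these two
model statements: (R1) is the Koma–Tasaki / Lieb–Seiringer–Yngvason "order at vanishing excess energy density ⇒ order
on the ground floor" converse, (R2') the exclusion of a tower collision between the adjacent floors.  Neither is
claimed here.

Sources: T. Koma, H. Tasaki, J. Stat. Phys. 76 (1994) 745; H. Tasaki, J. Stat. Phys. 174 (2019) 735 §5;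
E. H. Lieb, R. Seiringer, J. Yngvason, Rep. Math. Phys. 59 (2007) 389 (the open converse).  Pure logic over landed
theorems; no new definitions (all statements spelled out on the tree's vocabulary).
-/

-- the mandated namespace `Summit.<Summit>.<Problem>.Theorems` repeats `HubbardSuperconductivity`
-- (single-problem summit, D-0017), which the `dupNamespace` linter flags on every declaration
set_option linter.dupNamespace false

namespace Summit.HubbardSuperconductivity.HubbardSuperconductivity.Theorems.JosephsonMirror

open Matrix Literature.MathematicalPhysics.QuantumLattice Filter
open Summit.HubbardSuperconductivity.HubbardSuperconductivity.Theses.JosephsonMirror (JmInterchange)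

/-- **A ground state has zero excess.**  Floor order of `(N_L, 0)` (eventually some unit ground state `g` with
`‖Δ_d g‖² ≥ cL⁴`) is zero-excess pair order with the same constant (`n = N_L`, `v = g`, excess `0 ≤ εL²`):
`Re⟨g, Hg⟩ = e(N_L)` from `Hg = e(N_L) g` and `‖g‖ = 1`. [folklore] -/
theorem zeroExcessPairOrder_of_floorOrder (U δ : ℝ)
    (hF : ∃ c : ℝ, 0 < c ∧ ∃ L₀ : ℕ, ∀ (L : ℕ) [NeZero L], Even L → L₀ ≤ L →
      ∃ g : Fock (Orb (FermionTorus 2 L)),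
        IsGroundStateInSector (hubbardTorus 2 L 1 U) (2 * ⌊(1 - δ) * (L : ℝ) ^ 2 / 2⌋₊) 0 g ∧
        star g ⬝ᵥ g = 1 ∧
        c * (L : ℝ) ^ 4 ≤
          (star (pairField dWaveFormFactor L *ᵥ g) ⬝ᵥ (pairField dWaveFormFactor L *ᵥ g)).re) :
    ∃ c : ℝ, 0 < c ∧ ∀ ε : ℝ, 0 < ε → ∃ L₀ : ℕ, ∀ (L : ℕ) [NeZero L], Even L → L₀ ≤ L →
      ∃ n : ℕ, (n = (2 * ⌊(1 - δ) * (L : ℝ) ^ 2 / 2⌋₊) ∨ n = (2 * ⌊(1 - δ) * (L : ℝ) ^ 2 / 2⌋₊) - 2) ∧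
        ∃ v : Fock (Orb (FermionTorus 2 L)), v ∈ szSector n 0 ∧ star v ⬝ᵥ v = 1 ∧
          (star v ⬝ᵥ (hubbardTorus 2 L 1 U *ᵥ v)).re ≤
              (hubbardTorus 2 L 1 U).minEnergyOn (szSector n 0) + ε * (L : ℝ) ^ 2 ∧
          c * (L : ℝ) ^ 4 ≤
            (star (pairField dWaveFormFactor L *ᵥ v) ⬝ᵥ (pairField dWaveFormFactor L *ᵥ v)).re := by
  obtain ⟨c, hc, L₀, hL₀⟩ := hF
  refine ⟨c, hc, fun ε hε => ⟨L₀, fun L _ hE hL => ?_⟩⟩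
  obtain ⟨g, hg, hg1, hord⟩ := hL₀ L hE hL
  refine ⟨2 * ⌊(1 - δ) * (L : ℝ) ^ 2 / 2⌋₊, Or.inl rfl, g, hg.1, hg1, ?_, hord⟩
  have hre : (star g ⬝ᵥ (hubbardTorus 2 L 1 U *ᵥ g)).re =
      (hubbardTorus 2 L 1 U).minEnergyOn (szSector (2 * ⌊(1 - δ) * (L : ℝ) ^ 2 / 2⌋₊) 0) := by
    rw [hg.2.2, dotProduct_smul, hg1, smul_eq_mul, mul_one, Complex.ofReal_re]
  rw [hre]
  have : 0 ≤ ε * (L : ℝ) ^ 2 := by positivity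
  linarith

/-- **The crux implies its second residual (R2').**  If `JmInterchange` holds then, at every `U > 0`,
`δ ∈ (0, 1/2)`, FLOOR ORDER of `(N_L, 0)` implies the GROUND-FLOOR PAIR BRIDGE (the conclusion of the crux,
verbatim): a ground state has zero excess (`zeroExcessPairOrder_of_floorOrder`) and the crux in single-layer form
(`jmInterchange_iff_singleLayerForm`) bridges zero-excess pair order.  Koma–Tasaki (1994). [folklore] -/
theorem floorBridge_of_floorOrder_of_jmInterchange :
    JmInterchange → ∀ (U δ : ℝ), 0 < U → δ ∈ Set.Ioo (0:ℝ) (1 / 2) →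
      (∃ c : ℝ, 0 < c ∧ ∃ L₀ : ℕ, ∀ (L : ℕ) [NeZero L], Even L → L₀ ≤ L →
        ∃ g : Fock (Orb (FermionTorus 2 L)),
          IsGroundStateInSector (hubbardTorus 2 L 1 U) (2 * ⌊(1 - δ) * (L : ℝ) ^ 2 / 2⌋₊) 0 g ∧
          star g ⬝ᵥ g = 1 ∧
          c * (L : ℝ) ^ 4 ≤
            (star (pairField dWaveFormFactor L *ᵥ g) ⬝ᵥ (pairField dWaveFormFactor L *ᵥ g)).re) →
      ∃ a' : ℝ, 0 < a' ∧ ∃ L₀ : ℕ, ∀ (L : ℕ) [NeZero L], Even L → L₀ ≤ L → ∃ φ χ : Literature.MathematicalPhysics.QuantumLattice.Fock (Literature.MathematicalPhysics.QuantumLattice.Orb (Literature.MathematicalPhysics.QuantumLattice.FermionTorus 2 L)), Literature.MathematicalPhysics.QuantumLattice.IsGroundStateInSector (Literature.MathematicalPhysics.QuantumLattice.hubbardTorus 2 L 1 U) (2 * ⌊(1 - δ) * (L : ℝ) ^ 2 / 2⌋₊) 0 φ ∧ star φ ⬝ᵥ φ = 1 ∧ Literature.MathematicalPhysics.QuantumLattice.IsGroundStateInSector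 (Literature.MathematicalPhysics.QuantumLattice.hubbardTorus 2 L 1 U) (2 * ⌊(1 - δ) * (L : ℝ) ^ 2 / 2⌋₊ - 2) 0 χ ∧ star χ ⬝ᵥ χ = 1 ∧ a' * (L : ℝ) ^ 4 ≤ ‖star χ ⬝ᵥ Matrix.mulVec (Literature.MathematicalPhysics.QuantumLattice.pairField Literature.MathematicalPhysics.QuantumLattice.dWaveFormFactor L) φ‖ ^ 2 := by
  intro hJ U δ hU hδ hF
  exact (jmInterchange_iff_singleLayerForm.mp hJ) U δ hU hδ (zeroExcessPairOrder_of_floorOrder U δ hF)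

/-- **Exact two-residue normal form of the crux `JmInterchange`.**  `JmInterchange` holds iff BOTH single-layer
statements hold at every `U > 0`, `δ ∈ (0, 1/2)`: (R1) zero-excess `d`-wave pair order (in sector `N_L` or `N_L − 2`,
`S^z = 0`, excess `≤ εL²` for every `ε > 0`, intensity `≥ cL⁴`) implies floor order of `(N_L, 0)` (some unit ground
state with `‖Δ_d g‖² ≥ c'L⁴`), and (R2') floor order of `(N_L, 0)` implies the ground-floor pair bridge
`|⟨χ, Δ_d φ⟩|² ≥ a'L⁴` between `G(N_L, 0)` and `G(N_L − 2, 0)`.  `→`: `floorOrder_of_zeroExcessPairOrder_of_jmInterchange`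
and `floorBridge_of_floorOrder_of_jmInterchange`; `←`: compose (R1), (R2') and `jmInterchange_iff_singleLayerForm`.
Koma–Tasaki (1994); Tasaki (2019) §5; Lieb–Seiringer–Yngvason (2007) (the open converse that (R1) instantiates).
[folklore] -/
theorem jmInterchange_iff_reachesFloor_and_bridges :
    JmInterchange ↔
      ((∀ (U δ : ℝ), 0 < U → δ ∈ Set.Ioo (0:ℝ) (1 / 2) →
        (∃ c : ℝ, 0 < c ∧ ∀ ε : ℝ, 0 < ε → ∃ L₀ : ℕ, ∀ (L : ℕ) [NeZero L], Even L → L₀ ≤ L →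
            ∃ n : ℕ, (n = (2 * ⌊(1 - δ) * (L : ℝ) ^ 2 / 2⌋₊) ∨ n = (2 * ⌊(1 - δ) * (L : ℝ) ^ 2 / 2⌋₊) - 2) ∧
              ∃ v : Fock (Orb (FermionTorus 2 L)), v ∈ szSector n 0 ∧ star v ⬝ᵥ v = 1 ∧
                (star v ⬝ᵥ (hubbardTorus 2 L 1 U *ᵥ v)).re ≤
                    (hubbardTorus 2 L 1 U).minEnergyOn (szSector n 0) + ε * (L : ℝ) ^ 2 ∧
                c * (L : ℝ) ^ 4 ≤
                  (star (pairField dWaveFormFactor L *ᵥ v) ⬝ᵥ (pairField dWaveFormFactor L *ᵥ v)).re) →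
        ∃ c : ℝ, 0 < c ∧ ∃ L₀ : ℕ, ∀ (L : ℕ) [NeZero L], Even L → L₀ ≤ L →
          ∃ g : Fock (Orb (FermionTorus 2 L)),
            IsGroundStateInSector (hubbardTorus 2 L 1 U) (2 * ⌊(1 - δ) * (L : ℝ) ^ 2 / 2⌋₊) 0 g ∧
            star g ⬝ᵥ g = 1 ∧
            c * (L : ℝ) ^ 4 ≤
              (star (pairField dWaveFormFactor L *ᵥ g) ⬝ᵥ (pairField dWaveFormFactor L *ᵥ g)).re) ∧
       (∀ (U δ : ℝ), 0 < U → δ ∈ Set.Ioo (0:ℝ) (1 / 2) →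
        (∃ c : ℝ, 0 < c ∧ ∃ L₀ : ℕ, ∀ (L : ℕ) [NeZero L], Even L → L₀ ≤ L →
          ∃ g : Fock (Orb (FermionTorus 2 L)),
            IsGroundStateInSector (hubbardTorus 2 L 1 U) (2 * ⌊(1 - δ) * (L : ℝ) ^ 2 / 2⌋₊) 0 g ∧
            star g ⬝ᵥ g = 1 ∧
            c * (L : ℝ) ^ 4 ≤
              (star (pairField dWaveFormFactor L *ᵥ g) ⬝ᵥ (pairField dWaveFormFactor L *ᵥ g)).re) →
        ∃ a' : ℝ, 0 < a' ∧ ∃ L₀ : ℕ, ∀ (L : ℕ) [NeZero L], Even L → L₀ ≤ L → ∃ φ χ : Literature.MathematicalPhysics.QuantumLattice.Fock (Literature.MathematicalPhysics.QuantumLattice.Orb (Literature.MathematicalPhysics.QuantumLattice.FermionTorus 2 L)), Literature.MathematicalPhysics.QuantumLattice.IsGroundStateInSector (Literature.MathematicalPhysics.QuantumLattice.hubbardTorus 2 L 1 U) (2 * ⌊(1 - δ) * (L : ℝ) ^ 2 / 2⌋₊) 0 φ ∧ star φ ⬝ᵥ φ = 1 ∧ Literature.MathematicalPhysics.QuantumLattice.IsGroundStateInSector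 (Literature.MathematicalPhysics.QuantumLattice.hubbardTorus 2 L 1 U) (2 * ⌊(1 - δ) * (L : ℝ) ^ 2 / 2⌋₊ - 2) 0 χ ∧ star χ ⬝ᵥ χ = 1 ∧ a' * (L : ℝ) ^ 4 ≤ ‖star χ ⬝ᵥ Matrix.mulVec (Literature.MathematicalPhysics.QuantumLattice.pairField Literature.MathematicalPhysics.QuantumLattice.dWaveFormFactor L) φ‖ ^ 2)) := by
  constructor
  · intro hJ
    exact ⟨floorOrder_of_zeroExcessPairOrder_of_jmInterchange hJ, floorBridge_of_floorOrder_of_jmInterchange hJ⟩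
  · rintro ⟨h₁, h₂⟩
    rw [jmInterchange_iff_singleLayerForm]
    intro U δ hU hδ hZ
    exact h₂ U δ hU hδ (h₁ U δ hU hδ hZ)

end Summit.HubbardSuperconductivity.HubbardSuperconductivity.Theorems.JosephsonMirror
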